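import Literature.NumberTheory.EllipticCurves.X049ThetaDictionary
import Literature.NumberTheory.EllipticCurves.SqrtTwoTwistPointCount
import Literature.NumberTheory.EllipticCurves.ComplexMultiplicationMaximalOrderProofs
import Literature.NumberTheory.QuadraticFields.DiscriminantCharacter
import HarnessLib

/-!
# The quadratic twists of `X₀(49)`: `a_n(E'_d) = χ_d(n) a_n(49a1)` for Rajwade's family `E'_d : y² = x(x² + 21dx + 112d²)`,
# and `L(W, s)` is entire for EVERY elliptic curve `W/ℚ` with `j(W) = −3375` — modulo the group order formula

Topic `Literature/NumberTheory/EllipticCurves`, namespace `Literature.NumberTheory.EllipticCurves.X049` (sequel to `X049ThetaDictionary`).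
THEOREMS ONLY.  Rajwade's Theorem 4 for general `D`: «`L_D(s) = Σ_{λ ≡ 1,2,4 (mod √−7)} (D/λ) λ̄ (Nλ)^{−s}`», i.e. `L(E'_D, s)` is the twist
of `L(X₀(49), s)` by the quadratic character of `ℚ(√D)`, for the tree's model `cm28Codomain d = [0, 21d, 0, 112d², 0]` of
`E'_d : y² = x(x² + 21dx + 112d²)` (`d` square-free; `E'_1 ≅ 49a1`), and Hecke's continuation for the whole `j = −3375` class:

* `lFunction_apply_prime_twist` — `a_p(E'_d) = (d/p)·a_p(49a1)` at every odd prime `p ∤ 7d` (the twist law for the character sums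
  `Σ_x χ(x³ + 21dx² + 112d²x) = χ(d) Σ_x χ(x³ + 21x² + 112x)`, `SqrtTwoTwist.sum_quadraticChar_twist`); `a_{2^k}(E'_d) = (2/|d|)^k a_{2^k}`
  for `d ≡ 1 (mod 4)` (the tree's `2`-integral models `cm28GoodCodomain₁/₅`); `a_{p^{k+1}}(E'_d) = 0` at the additive primes
  (`7`, odd `p ∣ d`, and `2` unless `d ≡ 1 (mod 4)`; `ComplexMultiplicationLocalFactors28`);
* ★ `lFunction_twist_of_one_mod_four` / `lFunction_twist_of_not_one_mod_four` — **for every `n`: `a_n(E'_d) = (n/|d|)·a_n(49a1)`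
  (`d ≡ 1 (mod 4)`), resp. `a_n(E'_d) = 𝟙[n odd]·(d/n)·a_n(49a1)` (`d ≢ 1 (mod 4)`)** — Kronecker's character of `ℚ(√d)` written with
  Jacobi symbols (Cox (1.17)–(1.18): `(m/|D|) = (D/m)` for `D ≡ 1 (mod 4)`, the tree's `Quadratic.jacobiSym_natCast_natAbs_eq`);
* ★ `hasEntireLFunction_cm28Codomain` — **`L(E'_d, s)` is entire for every square-free `d ≠ 0`**, and
* ★★ `hasEntireLFunction_of_j_eq_neg3375` — **`W.HasEntireLFunction` for EVERY elliptic curve `W/ℚ` with `j(W) = −3375`**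
  (every such `W` is `ℚ`-isomorphic to an `E'_d`, Silverman X.5.4: `exists_variableChange_eq_quadraticTwist_intCast_of_j_eq` +
  `map_cm28Codomain_eq_smul_quadraticTwist`; `hasEntireLFunction_smul_iff`), all MODULO `groupOrder_A7` (Silverberg 2010 (2.1): the sign
  of `a_p(49a1)` at the split primes).  This is the Deuring–Hecke leaf `hasEntireLFunction_of_j_mem_maximalCMJInvariants` (Silverman,
  *Advanced Topics*, II Cor. 10.5.1) at `j = −3375`, in particular for w1 g11's corner curves `W_p = ⟨1, −(21p+1)/4, 0, 7p², 0⟩ ≅ E'_{−p}`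
  and the cells `E'_{n}`, from ONE printed sign rule and Hecke's theta series in the kernel.  Nothing about BSD is proved here.

## References
* A. R. Rajwade, J. Austral. Math. Soc. A 24 (1977), (0.1), Thm. 3, Thm. 4. [Rajwade1977]
* A. Silverberg, Contemp. Math. 521 (2010), (2.1). [Silverberg2010]
* D. A. Cox, *Primes of the form x² + ny²*, 2nd ed. (2013), §1.C Lemma 1.14, (1.17)–(1.18). [Cox2013]
* J. H. Silverman, *The Arithmetic of Elliptic Curves*, 2nd ed. (2009), X.2 Prop. 2.4, X.5 Cor. 5.4.1, App. C §16. [SilvermanAEC2009]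
* J. H. Silverman, *Advanced Topics* (1994), II Cor. 10.5.1. [SilvermanATAEC1994]

## Mathlib / tree search
Tree: `WeierstrassCurve.{cm28Codomain, map_cm28Codomain, cm28Codomain_Δ, isElliptic_cm28Codomain_map, hasAdditiveReductionAt_cm28Codomain,
hasAdditiveReductionAt_cm28_two_of_three_mod_four, smul_cm28Codomain_eq₁, smul_cm28Codomain_eq₅, cm28GoodCodomain₁, cm28GoodCodomain₅, cm28Good_Δ,
not_two_dvd_343_mul_pow, natCard_cm28GoodCodomain₁_zmod_two, natCard_cm28GoodCodomain₅_zmod_two, LFunction_smul, hasEntireLFunction_smul_iff,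
LFunction_apply_prime_pow_add_two, isMultiplicative_LFunction, j_cm28', isElliptic_mk_twoTorsion_iff}`, `map_cm28Codomain_eq_smul_quadraticTwist`,
`exists_variableChange_eq_quadraticTwist_intCast_of_j_eq`, `SqrtTwoTwist.{natCard_point_eq_card_add_one_add_sum, sum_quadraticChar_twist}`,
`hasGoodReductionAt_map_of_not_dvd`, `Automorphic.{numPointsMod, frobeniusTrace, lFunction_map_apply_prime_of_not_dvd}`,
`SexticTwist.lFunction_apply_prime_pow_of_hasAdditiveReductionAt`, `Quadratic.jacobiSym_natCast_natAbs_eq`, `X049.{E, E_eq_cm28GoodCodomain₁_zero,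
lFunction_apply_two, lFunction_apply_seven_pow, hasGoodReductionAt, exists_differentiable_twist}`.  Mathlib: `jacobiSym.{mul_left, mul_right', pow_left,
pow_right, mod_left, mod_right, at_two, eq_zero_iff_not_coprime, sq_one, legendreSym.to_jacobiSym}`, `ZMod.χ₈_nat_eq_if_mod_eight`, `Nat.recOnPosPrimePosCoprime`.
-/

noncomputable section

open scoped Classical NumberTheorySymbols

namespace Literature.NumberTheory.EllipticCurves

namespace X049

open _root_.WeierstrassCurve IsDedekindDomain NumberField Rat.HeightOneSpectrum Literature.NumberTheory.Automorphic
  Literature.NumberTheory.QuadraticFields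

/-! ### §1 `E'_1 ≅ 49a1`; the good odd primes: `a_p(E'_d) = (d/p) a_p(49a1)` -/

/-- The place of `ℚ` over a prime. [folklore] -/
private theorem exists_place' (p : ℕ) (hp : p.Prime) : ∃ v : HeightOneSpectrum (𝓞 ℚ), (primesEquiv v : ℕ) = p :=
  ⟨primesEquiv.symm ⟨p, hp⟩, by rw [Equiv.apply_symm_apply]⟩

/-- **`L(E'_1, s) = L(49a1, s)`**: `E'_1 = [0, 21, 0, 112, 0]` is `ℚ`-isomorphic to `49a1 = ⟨1, −1, 0, −2, −1⟩` (the tree's `2`-integral model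
`⟨2, −8, 1, 0⟩ • E'_1 = cm28GoodCodomain₁ 0`), and `L` is an isomorphism invariant. [cite: Rajwade1977, (0.1)] [cite: SilvermanAEC2009, App. C §16] -/
theorem lFunction_cm28Codomain_one : ((cm28Codomain 1).map (Int.castRingHom ℚ)).LFunction = (E.map (Int.castRingHom ℚ)).LFunction := by
  haveI := isElliptic_cm28Codomain_map (d := 1) one_ne_zero
  have h := smul_cm28Codomain_eq₁ (k := 0)
  have h8 : (8 * 0 + 1 : ℤ) = 1 := by norm_num
  rw [h8, ← E_eq_cm28GoodCodomain₁_zero] at h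
  rw [← h, LFunction_smul]

/-- A prime `p ∤ 14d` does not divide `Δ(E'_d) = −2¹²7³d⁶`. [cite: Rajwade1977, §0 («a prime p good if p ∤ 14D»)] -/
theorem not_dvd_Δ_cm28Codomain {d : ℤ} {p : ℕ} (hp : p.Prime) (hp2 : p ≠ 2) (hpd : ¬ (p : ℤ) ∣ 7 * d) :
    ¬ (p : ℤ) ∣ (cm28Codomain d).Δ := by
  rw [cm28Codomain_Δ, dvd_neg]
  have hp' : Prime (p : ℤ) := Nat.prime_iff_prime_int.mp hp
  have h7 : ¬ (p : ℤ) ∣ 7 := fun h ↦ hpd (h.mul_right d)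
  have hd : ¬ (p : ℤ) ∣ d := fun h ↦ hpd (dvd_mul_of_dvd_right h 7)
  have h2 : ¬ (p : ℤ) ∣ 2 := fun h ↦ hp2 ((Nat.prime_dvd_prime_iff_eq hp Nat.prime_two).mp (by exact_mod_cast h))
  intro h
  rcases hp'.dvd_or_dvd h with h12 | h6
  · rcases hp'.dvd_or_dvd h12 with h4 | h3
    · exact h2 (hp'.dvd_of_dvd_pow h4)
    · exact h7 (hp'.dvd_of_dvd_pow h3)
  · exact hd (hp'.dvd_of_dvd_pow h6)

/-- **`#E'_d(𝔽_p) = p + 1 + (d/p) Σ_x χ(x³ + 21x² + 112x)`** at an odd prime `p ∤ 7d` (the twist law `x ↦ dx` on the character sum).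
[cite: Rajwade1977, Thm 3 (proof, (d/π)₂ = (d/p))] -/
theorem numPointsMod_cm28Codomain (d : ℤ) {p : ℕ} [Fact p.Prime] (hp2 : p ≠ 2) (hpd : ¬ (p : ℤ) ∣ 7 * d) :
    (numPointsMod (cm28Codomain d) p : ℤ) =
      p + 1 + legendreSym p d * ∑ x : ZMod p, quadraticChar (ZMod p) (x ^ 3 + 21 * x ^ 2 + 112 * x) := by
  have hp : p.Prime := Fact.out
  have hchar : ringChar (ZMod p) ≠ 2 := by rwa [ZMod.ringChar_zmod_n]
  have hd0 : ((d : ℤ) : ZMod p) ≠ 0 := fun h ↦ hpd (dvd_mul_of_dvd_right ((ZMod.intCast_zmod_eq_zero_iff_dvd d p).mp h) 7)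
  have hΔ : (⟨0, 21 * (d : ZMod p), 0, 112 * (d : ZMod p) ^ 2, 0⟩ : WeierstrassCurve (ZMod p)).Δ ≠ 0 := by
    rw [← map_cm28Codomain d (Int.castRingHom (ZMod p)), map_Δ, eq_intCast]
    exact fun h ↦ not_dvd_Δ_cm28Codomain hp hp2 hpd ((ZMod.intCast_zmod_eq_zero_iff_dvd _ p).mp h)
  unfold numPointsMod
  rw [map_cm28Codomain, SqrtTwoTwist.natCard_point_eq_card_add_one_add_sum hchar _ _ hΔ, ZMod.card,
    SqrtTwoTwist.sum_quadraticChar_twist 21 112 hd0]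
  rfl

/-- **The twist law `a_p(E'_d) = (d/p) a_p(E'_1)`** on the `ℤ`-models, at an odd prime `p ∤ 7d`. [cite: Rajwade1977, Thm 3] -/
theorem frobeniusTrace_cm28Codomain (d : ℤ) {p : ℕ} (hp : p.Prime) (hp2 : p ≠ 2) (hpd : ¬ (p : ℤ) ∣ 7 * d) :
    frobeniusTrace (cm28Codomain d) p = J(d | p) * frobeniusTrace (cm28Codomain 1) p := by
  haveI := Fact.mk hp
  have h1 : ¬ (p : ℤ) ∣ 7 * 1 := by
    rw [mul_one]; exact fun h ↦ hpd (h.mul_right d)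
  rw [Automorphic.frobeniusTrace, Automorphic.frobeniusTrace, numPointsMod_cm28Codomain d hp2 hpd,
    numPointsMod_cm28Codomain 1 hp2 h1, ← jacobiSym.legendreSym.to_jacobiSym, legendreSym.at_one]
  ring

/-- **`a_p(E'_d) = (d/p) · a_p(49a1)` at every odd prime `p ∤ 7d`** (`d ≠ 0`), on Mathlib's `L`-functions. [cite: Rajwade1977, Thm 3 and Thm 4] -/
theorem lFunction_apply_prime_twist {d : ℤ} {p : ℕ} (hp : p.Prime) (hp2 : p ≠ 2) (hpd : ¬ (p : ℤ) ∣ 7 * d) :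
    ((cm28Codomain d).map (Int.castRingHom ℚ)).LFunction p = J(d | p) * (E.map (Int.castRingHom ℚ)).LFunction p := by
  have h1 : ¬ (p : ℤ) ∣ 7 * 1 := by
    rw [mul_one]; exact fun h ↦ hpd (h.mul_right d)
  rw [lFunction_map_apply_prime_of_not_dvd _ hp (not_dvd_Δ_cm28Codomain hp hp2 hpd), frobeniusTrace_cm28Codomain d hp hp2 hpd,
    ← lFunction_cm28Codomain_one, lFunction_map_apply_prime_of_not_dvd _ hp (not_dvd_Δ_cm28Codomain hp hp2 h1)]

/-- `E'_d` has good reduction at every odd prime `p ∤ 7d`. [cite: SilvermanAEC2009, VII.5 Prop. 5.1(a)] -/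
theorem hasGoodReductionAt_cm28Codomain {d : ℤ} (v : HeightOneSpectrum (𝓞 ℚ)) (hv2 : (primesEquiv v : ℕ) ≠ 2)
    (hvd : ¬ ((primesEquiv v : ℕ) : ℤ) ∣ 7 * d) : ((cm28Codomain d).map (Int.castRingHom ℚ)).HasGoodReductionAt v :=
  hasGoodReductionAt_map_of_not_dvd _ v (not_dvd_Δ_cm28Codomain (primesEquiv v).2 hv2 hvd)

/-! ### §2 Prime powers: a generic comparison, the additive primes, the prime `2` -/

/-- **Twisted Euler factors at a common good prime**: if `W`, `W'` have good reduction at `p` and `a_p(W') = ε a_p(W)` with `ε² = 1`, then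
`a_{p^k}(W') = ε^k a_{p^k}(W)` for all `k` (both satisfy `a_{p^{k+2}} = a_p a_{p^{k+1}} − p a_{p^k}`). [cite: SilvermanAEC2009, X.2 Prop. 2.4 with App. C §16] -/
theorem lFunction_prime_pow_eq_pow_mul {W W' : WeierstrassCurve ℚ} (v : HeightOneSpectrum (𝓞 ℚ)) (hW : W.HasGoodReductionAt v)
    (hW' : W'.HasGoodReductionAt v) {ε : ℤ} (hε : ε ^ 2 = 1)
    (h1 : W'.LFunction (primesEquiv v : ℕ) = ε * W.LFunction (primesEquiv v : ℕ)) (k : ℕ) :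
    W'.LFunction ((primesEquiv v : ℕ) ^ k) = ε ^ k * W.LFunction ((primesEquiv v : ℕ) ^ k) := by
  set p : ℕ := (primesEquiv v : ℕ) with hp
  have hrec : ∀ k, W.LFunction (p ^ (k + 2)) = W.LFunction p * W.LFunction (p ^ (k + 1)) - (p : ℤ) * W.LFunction (p ^ k) := by
    intro k
    have h := W.LFunction_apply_prime_pow_add_two v k
    rw [if_pos hW] at h
    exact h
  have hrec' : ∀ k, W'.LFunction (p ^ (k + 2)) = W'.LFunction p * W'.LFunction (p ^ (k + 1)) - (p : ℤ) * W'.LFunction (p ^ k) := by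
    intro k
    have h := W'.LFunction_apply_prime_pow_add_two v k
    rw [if_pos hW'] at h
    exact h
  suffices H : ∀ k, W'.LFunction (p ^ k) = ε ^ k * W.LFunction (p ^ k) ∧ W'.LFunction (p ^ (k + 1)) = ε ^ (k + 1) * W.LFunction (p ^ (k + 1)) from
    (H k).1
  intro k
  induction k with
  | zero =>
    refine ⟨?_, ?_⟩
    · rw [pow_zero, pow_zero, W.isMultiplicative_LFunction.map_one, W'.isMultiplicative_LFunction.map_one, one_mul]
    · rw [zero_add, pow_one, pow_one, h1]
  | succ k ih =>
    refine ⟨ih.2, ?_⟩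
    rw [show k + 1 + 1 = k + 2 by ring, hrec' k, hrec k, ih.1, ih.2, h1]
    have hε2 : ε ^ (k + 2) = ε ^ k := by rw [pow_add, hε, mul_one]
    rw [hε2, pow_succ]
    linear_combination (ε ^ k * W.LFunction p * W.LFunction (p ^ (k + 1))) * hε

/-- **`a_{p^{j+1}}(E'_d) = 0` at the additive primes of `E'_d`** (`d` square-free): `p = 7`, odd `p ∣ d`, and `p = 2` when `2 ∣ d` or `d ≡ 3 (mod 4)`.
[cite: Rajwade1977, §0] [cite: SilvermanAEC2009, App. C §16] -/
theorem lFunction_apply_prime_pow_eq_zero_of_additive {d : ℤ} (hsq : Squarefree d) {p : ℕ} (hp : p.Prime)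
    (h : (p : ℤ) ∣ 7 * d ∨ (p = 2 ∧ ((2 : ℤ) ∣ d ∨ d % 4 = 3))) (j : ℕ) :
    ((cm28Codomain d).map (Int.castRingHom ℚ)).LFunction (p ^ (j + 1)) = 0 := by
  obtain ⟨v, hv⟩ := exists_place' p hp
  have hv' : natGenerator v = p := hv
  have hadd : ((cm28Codomain d).map (Int.castRingHom ℚ)).HasAdditiveReductionAt v := by
    rcases h with h7d | ⟨rfl, h2 | h3⟩
    · exact hasAdditiveReductionAt_cm28Codomain v hsq (Or.inl (by rw [hv']; exact h7d))
    · exact hasAdditiveReductionAt_cm28Codomain v hsq (Or.inr ⟨hv', h2⟩)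
    · obtain ⟨k, hk⟩ : ∃ k, d = 4 * k + 3 := ⟨d / 4, by omega⟩
      exact (hasAdditiveReductionAt_cm28_two_of_three_mod_four v hv' hk).2
  have hz := SexticTwist.lFunction_apply_prime_pow_of_hasAdditiveReductionAt v _ hadd j
  rwa [hv'] at hz

/-- **`a_{2^k}(E'_d) = a_{2^k}(49a1)` for `d ≡ 1 (mod 8)`** (good ordinary reduction at `2` with `a₂ = 1` on both sides: the tree's model
`cm28GoodCodomain₁`). [cite: SilvermanAEC2009, App. C §16] [cite: Silverberg2010, (2.1)] -/
theorem lFunction_apply_two_pow_of_one_mod_eight {d k : ℤ} (hd : d = 8 * k + 1) (j : ℕ) :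
    ((cm28Codomain d).map (Int.castRingHom ℚ)).LFunction (2 ^ j) = (E.map (Int.castRingHom ℚ)).LFunction (2 ^ j) := by
  subst hd
  have hd0 : (8 * k + 1 : ℤ) ≠ 0 := by omega
  haveI := isElliptic_cm28Codomain_map hd0
  obtain ⟨v, hv⟩ := exists_place' 2 Nat.prime_two
  have hodd : ¬ (2 : ℤ) ∣ 8 * k + 1 := by omega
  have hΔ : ¬ ((primesEquiv v : ℕ) : ℤ) ∣ (cm28GoodCodomain₁ k).Δ := by
    rw [hv, (cm28Good_Δ (k := k)).2.2.1, dvd_neg]; exact not_two_dvd_343_mul_pow hodd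
  set M : WeierstrassCurve ℚ := (cm28GoodCodomain₁ k).map (Int.castRingHom ℚ) with hM
  have hLM : ((cm28Codomain (8 * k + 1)).map (Int.castRingHom ℚ)).LFunction = M.LFunction := by
    rw [hM, ← smul_cm28Codomain_eq₁, LFunction_smul]
  have hgoodM : M.HasGoodReductionAt v := hasGoodReductionAt_map_of_not_dvd _ v hΔ
  have hgoodE : (E.map (Int.castRingHom ℚ)).HasGoodReductionAt v := hasGoodReductionAt v (by rw [hv]; norm_num)
  have h2M : M.LFunction 2 = 1 := by
    rw [hM, lFunction_map_apply_prime_of_not_dvd _ Nat.prime_two (by rw [← hv]; exact hΔ), Automorphic.frobeniusTrace, numPointsMod,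
      natCard_cm28GoodCodomain₁_zmod_two]
    norm_num
  have h1 : M.LFunction (primesEquiv v : ℕ) = 1 * (E.map (Int.castRingHom ℚ)).LFunction (primesEquiv v : ℕ) := by
    rw [hv, h2M, lFunction_apply_two, one_mul]
  have h := lFunction_prime_pow_eq_pow_mul v hgoodE hgoodM (ε := 1) (by norm_num) h1 j
  rw [hv, one_pow, one_mul] at h
  rw [hLM, h]

/-- **`a_{2^k}(E'_d) = (−1)^k a_{2^k}(49a1)` for `d ≡ 5 (mod 8)`** (good reduction at `2` with `a₂ = −1`: the tree's model `cm28GoodCodomain₅`,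
four points mod `2`). [cite: SilvermanAEC2009, App. C §16] [cite: Silverberg2010, (2.1)] -/
theorem lFunction_apply_two_pow_of_five_mod_eight {d k : ℤ} (hd : d = 8 * k + 5) (j : ℕ) :
    ((cm28Codomain d).map (Int.castRingHom ℚ)).LFunction (2 ^ j) = (-1) ^ j * (E.map (Int.castRingHom ℚ)).LFunction (2 ^ j) := by
  subst hd
  have hd0 : (8 * k + 5 : ℤ) ≠ 0 := by omega
  haveI := isElliptic_cm28Codomain_map hd0
  obtain ⟨v, hv⟩ := exists_place' 2 Nat.prime_two
  have hodd : ¬ (2 : ℤ) ∣ 8 * k + 5 := by omega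
  have hΔ : ¬ ((primesEquiv v : ℕ) : ℤ) ∣ (cm28GoodCodomain₅ k).Δ := by
    rw [hv, (cm28Good_Δ (k := k)).2.2.2, dvd_neg]; exact not_two_dvd_343_mul_pow hodd
  set M : WeierstrassCurve ℚ := (cm28GoodCodomain₅ k).map (Int.castRingHom ℚ) with hM
  have hLM : ((cm28Codomain (8 * k + 5)).map (Int.castRingHom ℚ)).LFunction = M.LFunction := by
    rw [hM, ← smul_cm28Codomain_eq₅, LFunction_smul]
  have hgoodM : M.HasGoodReductionAt v := hasGoodReductionAt_map_of_not_dvd _ v hΔ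
  have hgoodE : (E.map (Int.castRingHom ℚ)).HasGoodReductionAt v := hasGoodReductionAt v (by rw [hv]; norm_num)
  have h2M : M.LFunction 2 = -1 := by
    rw [hM, lFunction_map_apply_prime_of_not_dvd _ Nat.prime_two (by rw [← hv]; exact hΔ), Automorphic.frobeniusTrace, numPointsMod,
      natCard_cm28GoodCodomain₅_zmod_two]
    norm_num
  have h1 : M.LFunction (primesEquiv v : ℕ) = -1 * (E.map (Int.castRingHom ℚ)).LFunction (primesEquiv v : ℕ) := by
    rw [hv, h2M, lFunction_apply_two]; ring
  have h := lFunction_prime_pow_eq_pow_mul v hgoodE hgoodM (ε := -1) (by norm_num) h1 j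
  rw [hv] at h
  rw [hLM, h]

/-- **`a_{p^k}(E'_d) = (d/p)^k a_{p^k}(49a1)` at an odd prime `p ∤ 7d`** (`d ≠ 0`). [cite: Rajwade1977, Thm 4] [cite: SilvermanAEC2009, X.2 Prop. 2.4] -/
theorem lFunction_apply_prime_pow_twist {d : ℤ} {p : ℕ} (hp : p.Prime) (hp2 : p ≠ 2) (hpd : ¬ (p : ℤ) ∣ 7 * d) (k : ℕ) :
    ((cm28Codomain d).map (Int.castRingHom ℚ)).LFunction (p ^ k) = J(d | p) ^ k * (E.map (Int.castRingHom ℚ)).LFunction (p ^ k) := by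
  haveI := Fact.mk hp
  obtain ⟨v, hv⟩ := exists_place' p hp
  have hp7 : p ≠ 7 := by
    rintro rfl; exact hpd ⟨d, by ring⟩
  have hpd' : ¬ (p : ℤ) ∣ d := fun h ↦ hpd (dvd_mul_of_dvd_right h 7)
  have hε : J(d | p) ^ 2 = 1 := by
    rw [← jacobiSym.legendreSym.to_jacobiSym]
    exact legendreSym.sq_one p (fun h ↦ hpd' ((ZMod.intCast_zmod_eq_zero_iff_dvd d p).mp h))
  have h := lFunction_prime_pow_eq_pow_mul v (hasGoodReductionAt v (by rw [hv]; exact hp7))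
    (hasGoodReductionAt_cm28Codomain v (by rw [hv]; exact hp2) (by rw [hv]; exact hpd)) hε
    (by rw [hv]; exact lFunction_apply_prime_twist hp hp2 hpd) k
  rwa [hv] at h

/-! ### §3 `a_n(E'_d) = χ_d(n) a_n(49a1)` for every `n` -/

/-- Case split on a prime relative to `7d`. [folklore] -/
private theorem prime_cases (d : ℤ) (p : ℕ) :
    p = 2 ∨ (p : ℤ) ∣ 7 * d ∨ (p ≠ 2 ∧ ¬ (p : ℤ) ∣ 7 * d) := by
  by_cases h2 : p = 2
  · exact Or.inl h2
  · by_cases h : (p : ℤ) ∣ 7 * d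
    · exact Or.inr (Or.inl h)
    · exact Or.inr (Or.inr ⟨h2, h⟩)

/-- `(p/|d|) = 0` for a prime `p ∣ d`. [cite: Cox2013, §1.C (Jacobi symbol)] -/
private theorem jacobiSym_natAbs_eq_zero_of_dvd {d : ℤ} (hd : d ≠ 0) {p : ℕ} (hp : p.Prime) (hpd : (p : ℤ) ∣ d) :
    J((p : ℤ) | d.natAbs) = 0 := by
  haveI : NeZero d.natAbs := ⟨Int.natAbs_ne_zero.mpr hd⟩
  rw [jacobiSym.eq_zero_iff_not_coprime]
  have hpd' : p ∣ d.natAbs := Int.natCast_dvd.mp hpd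
  rw [Int.gcd_natCast_natCast]
  intro h1
  have := Nat.dvd_gcd (dvd_refl p) hpd'
  rw [h1] at this
  exact hp.one_lt.ne' (Nat.dvd_one.mp this)

/-- `(d/p) = 0` for a prime `p ∣ d`. [cite: Cox2013, §1.C (Jacobi symbol)] -/
private theorem jacobiSym_eq_zero_of_dvd' {d : ℤ} {p : ℕ} (hp : p.Prime) (hpd : (p : ℤ) ∣ d) : J(d | p) = 0 := by
  haveI := Fact.mk hp
  rw [← jacobiSym.legendreSym.to_jacobiSym, legendreSym.eq_zero_iff]
  exact (ZMod.intCast_zmod_eq_zero_iff_dvd d p).mpr hpd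

/-- A prime `p ∣ 7d` with `p ≠ 7`, `7 ∤ d`… bookkeeping: `p ∣ 7d` means `p = 7` or `p ∣ d`. [folklore] -/
private theorem eq_seven_or_dvd_of_dvd {d : ℤ} {p : ℕ} (hp : p.Prime) (h : (p : ℤ) ∣ 7 * d) : p = 7 ∨ (p : ℤ) ∣ d := by
  rcases (Nat.prime_iff_prime_int.mp hp).dvd_or_dvd h with h7 | hd
  · left
    have : p ∣ 7 := by exact_mod_cast h7
    exact (Nat.prime_dvd_prime_iff_eq hp (by norm_num)).mp this
  · exact Or.inr hd

/-- ★ **`a_n(E'_d) = (n/|d|) · a_n(49a1)` for every `n`, when `d ≡ 1 (mod 4)` is square-free** — `L(E'_d, s) = L(49a1 ⊗ χ_d, s)` with Kronecker's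
character `χ_d(n) = (n/|d|)` of `ℚ(√d)` (Cox (1.18)).  Prime by prime: odd `p ∤ 7d` by the twist law and `(p/|d|) = (d/p)` (Cox (1.17)); `p = 2` by
the good models at `2` (`(2/|d|) = ±1` as `d ≡ 1, 5 (mod 8)`); `p ∣ d` and `p = 7`: both sides vanish. [cite: Rajwade1977, Thm 4] [cite: Cox2013, §1.C (1.17)–(1.18)] -/
theorem lFunction_twist_of_one_mod_four {d : ℤ} (hsq : Squarefree d) (hd4 : d % 4 = 1) (n : ℕ) :
    ((cm28Codomain d).map (Int.castRingHom ℚ)).LFunction n = J((n : ℤ) | d.natAbs) * (E.map (Int.castRingHom ℚ)).LFunction n := by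
  have hd : d ≠ 0 := by rintro rfl; norm_num at hd4
  haveI := isElliptic_cm28Codomain_map hd
  haveI : NeZero d.natAbs := ⟨Int.natAbs_ne_zero.mpr hd⟩
  induction n using Nat.recOnPosPrimePosCoprime with
  | zero => simp [ArithmeticFunction.map_zero]
  | one =>
    rw [((cm28Codomain d).map (Int.castRingHom ℚ)).isMultiplicative_LFunction.map_one,
      (E.map (Int.castRingHom ℚ)).isMultiplicative_LFunction.map_one, Nat.cast_one, jacobiSym.one_left, one_mul]
  | prime_pow p k hp hk =>
    obtain ⟨k', rfl⟩ : ∃ k', k = k' + 1 := ⟨k - 1, by omega⟩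
    rw [Nat.cast_pow, jacobiSym.pow_left]
    rcases prime_cases d p with rfl | h7d | ⟨hp2, hpd⟩
    · -- `p = 2`: `d ≡ 1 or 5 (mod 8)`
      have hd8 : (∃ k, d = 8 * k + 1) ∨ (∃ k, d = 8 * k + 5) := by
        rcases (show d % 8 = 1 ∨ d % 8 = 5 by omega) with h | h
        · exact Or.inl ⟨d / 8, by omega⟩
        · exact Or.inr ⟨d / 8, by omega⟩
      have hodd : Odd d.natAbs := by
        rw [Int.natAbs_odd, Int.odd_iff]; omega
      have h2 : J(((2 : ℕ) : ℤ) | d.natAbs) = if d % 8 = 1 then 1 else -1 := by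
        rw [Nat.cast_ofNat, jacobiSym.at_two hodd, ZMod.χ₈_nat_eq_if_mod_eight]
        have h8 : d.natAbs % 8 = 1 ∨ d.natAbs % 8 = 3 ∨ d.natAbs % 8 = 5 ∨ d.natAbs % 8 = 7 := by omega
        have hne : d.natAbs % 2 ≠ 0 := by omega
        rw [if_neg hne]
        by_cases h1 : d % 8 = 1
        · rw [if_pos h1, if_pos (by omega)]
        · rw [if_neg h1, if_neg (by omega)]
      rcases hd8 with ⟨k, hk⟩ | ⟨k, hk⟩
      · rw [lFunction_apply_two_pow_of_one_mod_eight hk, h2, if_pos (by omega), one_pow, one_mul]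
      · rw [lFunction_apply_two_pow_of_five_mod_eight hk, h2, if_neg (by omega)]
    · -- `p ∣ 7d`: additive for `E'_d`; `p = 7` or `p ∣ d`
      rw [lFunction_apply_prime_pow_eq_zero_of_additive hsq hp (Or.inl h7d)]
      rcases eq_seven_or_dvd_of_dvd hp h7d with rfl | hpd
      · rw [lFunction_apply_seven_pow, mul_zero]
      · rw [jacobiSym_natAbs_eq_zero_of_dvd hd hp hpd, zero_pow (Nat.succ_ne_zero k'), zero_mul]
    · -- odd `p ∤ 7d`
      rw [lFunction_apply_prime_pow_twist hp hp2 hpd, Quadratic.jacobiSym_natCast_natAbs_eq hd4 (hp.odd_of_ne_two hp2)]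
  | coprime a b ha hb hab iha ihb =>
    rw [((cm28Codomain d).map (Int.castRingHom ℚ)).isMultiplicative_LFunction.map_mul_of_coprime hab,
      (E.map (Int.castRingHom ℚ)).isMultiplicative_LFunction.map_mul_of_coprime hab, iha, ihb, Nat.cast_mul, jacobiSym.mul_left]
    ring

/-- ★ **`a_n(E'_d) = 𝟙[n odd] · (d/n) · a_n(49a1)` for every `n`, when `d ≢ 1 (mod 4)` is square-free** (`d ≡ 2, 3 (mod 4)`: `E'_d` is additive
at `2`, and `χ_{4d}(n) = (d/n)` on odd `n`). [cite: Rajwade1977, Thm 4] [cite: Cox2013, §1.C Lemma 1.14] -/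
theorem lFunction_twist_of_not_one_mod_four {d : ℤ} (hsq : Squarefree d) (hd4 : d % 4 ≠ 1) (n : ℕ) :
    ((cm28Codomain d).map (Int.castRingHom ℚ)).LFunction n =
      (if Odd n then J(d | n) else 0) * (E.map (Int.castRingHom ℚ)).LFunction n := by
  induction n using Nat.recOnPosPrimePosCoprime with
  | zero => simp [ArithmeticFunction.map_zero]
  | one =>
    rw [((cm28Codomain d).map (Int.castRingHom ℚ)).isMultiplicative_LFunction.map_one,
      (E.map (Int.castRingHom ℚ)).isMultiplicative_LFunction.map_one, if_pos odd_one, jacobiSym.one_right, one_mul]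
  | prime_pow p k hp hk =>
    obtain ⟨k', rfl⟩ : ∃ k', k = k' + 1 := ⟨k - 1, by omega⟩
    rcases prime_cases d p with rfl | h7d | ⟨hp2, hpd⟩
    · -- `p = 2`: additive (`2 ∣ d` or `d ≡ 3 (mod 4)`), and `2^{k'+1}` is even
      have h2 : (2 : ℤ) ∣ d ∨ d % 4 = 3 := by omega
      rw [lFunction_apply_prime_pow_eq_zero_of_additive hsq hp (Or.inr ⟨rfl, h2⟩),
        if_neg (Nat.not_odd_iff_even.mpr (Nat.even_pow.mpr ⟨even_two, Nat.succ_ne_zero k'⟩)), zero_mul]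
    · rw [lFunction_apply_prime_pow_eq_zero_of_additive hsq hp (Or.inl h7d)]
      rcases eq_seven_or_dvd_of_dvd hp h7d with rfl | hpd
      · rw [lFunction_apply_seven_pow, mul_zero]
      · rw [jacobiSym.pow_right, jacobiSym_eq_zero_of_dvd' hp hpd, zero_pow (Nat.succ_ne_zero k')]
        simp
    · rw [lFunction_apply_prime_pow_twist hp hp2 hpd, if_pos ((hp.odd_of_ne_two hp2).pow), jacobiSym.pow_right]
  | coprime a b ha hb hab iha ihb =>
    rw [((cm28Codomain d).map (Int.castRingHom ℚ)).isMultiplicative_LFunction.map_mul_of_coprime hab,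
      (E.map (Int.castRingHom ℚ)).isMultiplicative_LFunction.map_mul_of_coprime hab, iha, ihb,
      jacobiSym.mul_right' d (by omega) (by omega)]
    (by_cases hao : Odd a <;> by_cases hbo : Odd b <;> simp [hao, hbo, Nat.odd_mul]); ring

/-! ### §4 `L(E'_d, s)` is entire; `L(W, s)` is entire for every `W/ℚ` with `j(W) = −3375` -/

/-- The residue of `n` modulo an even modulus has the parity of `n`. [folklore] -/
private theorem odd_mod_iff {m n : ℕ} (hm : 2 ∣ m) : Odd (n % m) ↔ Odd n := by
  rw [Nat.odd_iff, Nat.odd_iff, Nat.mod_mod_of_dvd n hm]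

/-- ★ **`L(E'_d, s)` is entire for every square-free `d ≠ 0`** (`E'_d = [0, 21d, 0, 112d², 0]`, Rajwade's `y² = x(x² + 21dx + 112d²)`; `j = −3375`),
MODULO the group order formula `groupOrder_A7`: `L(E'_d, s) = Σ χ_d(n) a_n(49a1) n^{−s}` is a periodic twist of `L(49a1, s)`, entire by the theta
dictionary (`X049.exists_differentiable_twist`). [cite: Rajwade1977, Thm 4 and Thm 6] [cite: SilvermanATAEC1994, II Cor. 10.5.1] -/
theorem hasEntireLFunction_cm28Codomain (hG : groupOrder_A7) {d : ℤ} (hd : d ≠ 0) (hsq : Squarefree d) :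
    ((cm28Codomain d).map (Int.castRingHom ℚ)).HasEntireLFunction := by
  by_cases hd4 : d % 4 = 1
  · -- `χ_d(n) = (n/|d|)`, period `|d|`
    haveI : NeZero d.natAbs := ⟨Int.natAbs_ne_zero.mpr hd⟩
    obtain ⟨L, hL, hLs⟩ := exists_differentiable_twist hG d.natAbs (fun r ↦ (J((r.val : ℤ) | d.natAbs) : ℂ))
    refine ⟨L, hL, fun s hs ↦ ?_⟩
    rw [hLs s hs, WeierstrassCurve.LSeries]
    refine LSeries_congr (fun {n} _ ↦ ?_) s
    rw [Function.comp_apply, lFunction_twist_of_one_mod_four hsq hd4 n, ZMod.val_natCast, Int.natCast_mod, ← jacobiSym.mod_left]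
    push_cast
    ring
  · -- `χ_{4d}(n) = 𝟙[n odd](d/n)`, period `4|d|`
    haveI : NeZero (4 * d.natAbs) := ⟨Nat.mul_ne_zero (by norm_num) (Int.natAbs_ne_zero.mpr hd)⟩
    obtain ⟨L, hL, hLs⟩ := exists_differentiable_twist hG (4 * d.natAbs)
      (fun r ↦ if Odd r.val then (J(d | r.val) : ℂ) else 0)
    refine ⟨L, hL, fun s hs ↦ ?_⟩
    rw [hLs s hs, WeierstrassCurve.LSeries]
    refine LSeries_congr (fun {n} _ ↦ ?_) s
    have h4 : 2 ∣ 4 * d.natAbs := ⟨2 * d.natAbs, by ring⟩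
    rw [Function.comp_apply, lFunction_twist_of_not_one_mod_four hsq hd4 n, ZMod.val_natCast]
    by_cases hn : Odd n
    · rw [if_pos ((odd_mod_iff h4).mpr hn), if_pos hn, ← jacobiSym.mod_right d hn]
      push_cast
      ring
    · rw [if_neg (fun h ↦ hn ((odd_mod_iff h4).mp h)), if_neg hn]
      push_cast
      ring

/-- ★★ **`L(W, s)` is entire for EVERY elliptic curve `W/ℚ` with `j(W) = −3375`**, MODULO the group order formula `groupOrder_A7` (Silverberg 2010
(2.1) = Rajwade 1977 Thm. 3: the sign of `a_p(49a1)` at the split primes): `W` is `ℚ`-isomorphic to some `E'_d`, `d` square-free (Silverman X.5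
Cor. 5.4.1: `C • W = E'^{(d)}` for `E' = [0, 84, 0, 1792, 0]`, and `E'_d = ⟨2, 0, 0, 0⟩ • E'^{(d)}`), and `HasEntireLFunction` is an isomorphism
invariant.  This is the Deuring–Hecke continuation leaf `hasEntireLFunction_of_j_mem_maximalCMJInvariants` (Silverman, *Advanced Topics*,
II Cor. 10.5.1) on the whole class `j = −3375`, from Hecke's theta series in the kernel and one printed sign rule; no modularity, no CM theory.
[cite: SilvermanATAEC1994, II Cor. 10.5.1] [cite: SilvermanAEC2009, X.5 Cor. 5.4.1] [cite: Rajwade1977, Thm 4 and Thm 6] -/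
theorem hasEntireLFunction_of_j_eq_neg3375 (hG : groupOrder_A7) (W : WeierstrassCurve ℚ) [W.IsElliptic] (hj : W.j = -3375) :
    W.HasEntireLFunction := by
  haveI hE' : (⟨0, 84, 0, 1792, 0⟩ : WeierstrassCurve ℚ).IsElliptic := (isElliptic_mk_twoTorsion_iff 84 1792).mpr (by norm_num)
  have hjE : (⟨0, 84, 0, 1792, 0⟩ : WeierstrassCurve ℚ).j = -3375 := j_cm28'
  obtain ⟨d, hd, hsq, C, hC⟩ := exists_variableChange_eq_quadraticTwist_intCast_of_j_eq (W := W) (E := ⟨0, 84, 0, 1792, 0⟩)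
    (by rw [hj, hjE]) (by rw [hjE]; norm_num) (by rw [hjE]; norm_num)
  haveI : ((⟨0, 84, 0, 1792, 0⟩ : WeierstrassCurve ℚ).quadraticTwist (d : ℚ)).IsElliptic :=
    isElliptic_quadraticTwist _ (Int.cast_ne_zero.mpr hd)
  have h1 : ((cm28Codomain d).map (Int.castRingHom ℚ)).HasEntireLFunction := hasEntireLFunction_cm28Codomain hG hd hsq
  rw [map_cm28Codomain_eq_smul_quadraticTwist d, hasEntireLFunction_smul_iff, ← hC, hasEntireLFunction_smul_iff] at h1
  exact h1

end X049

end Literature.NumberTheory.EllipticCurves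

end
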